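import Summits.CriticalPhenomena.PercolationContinuityZ3.Theorems.PercNearOneGluingNoHeavyQuantCatHullLeafCore
import Summits.CriticalPhenomena.PercolationContinuityZ3.Theorems.PercNearOneGluingNoHeavyQuantCatHullShiftCheck
import HarnessLib

/-!
# QUANT lane R8, T-DEC: THE EXACT `leaf` CHECK FOR PIECEWISE-AFFINE TABLES — a leaf shape (three atoms, a mode, a blob size) read at a box vertex is
# `G·(c₀ + c₁x + c₂x²)` against the piece `a + bG + c·A`, `A = G·(r₀ + r₁x)`, `x = y/G`: the box predicate `Tab.leafBoxOK` and its soundness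

builds on p205010 (kernel theorem, internal audit signed; external expert review pending)

Support file (`--supports stmt-CriticalPhenomena-4575`), QUANT lane census seat prim-quant-census-2 (gen 78).  Definitions + theorems; standard axioms,
no sorries.  A LEAF SHAPE (`Tab.Shape`: atoms `h₀,h₁,h₂`, mode `zero | seg | tri`, blob size `a`) describes the law `ν` hung below a blob with gate
`g = x + (1−x)t_g`: mode `zero` is `δ_{h₀}`, `seg` puts mass `p₁ = x + (1−x)t₁` on `h₁`, `tri` puts `p₅ = x + (1−x)t₅` on `h₂` and `p₁ = (1−p₅)t₁` on `h₁`
(the regions `A₄(x)`, `F₅(x)` of `…QuantCatHullTinySupport` in unit-box coordinates).  `Tab.lhsG` / `Tab.rate` are the leaf functional and the mean rate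
(both over any commutative ring, so the checker computes in `ℚ` what the theorem states in `ℝ`); `Tab.coef3` extracts the `x`-coefficients by
interpolation (`Tab.lhsG_eq_poly`, by `ring`); `Tab.leafBoxOK` checks one box (vertex-wise quadratic tests against the one or two `A`-cells met) and
`Tab.leafBox_sound` proves `G·lhsG ≤ Z(G, G·rate)` on the box via `box_nonneg₁₂₃` and `quadOK_sound`.  [this work].  Nothing here is cited as a
published result.  The gluing rows served [cite: KozmaNitzan2024, Conjecture 3 (p. 15)]; product measure [cite: Grimmett1999, §1.3 p. 10].
-/

noncomputable section

namespace Summit.CriticalPhenomena.PercolationContinuityZ3.Theorems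
namespace Quant
namespace LawDec
namespace Tab

/-- the three modes of a tiny region in unit-box coordinates. [this work] -/
inductive Mode where
  | zero | seg | tri
  deriving DecidableEq

/-- number of box parameters besides `t_g`. [this work] -/
def Mode.dim : Mode → ℕ
  | Mode.zero => 0
  | Mode.seg => 1
  | Mode.tri => 2

/-- a leaf shape: the blob size `a`, the three atoms of the sub-law (relative to the offset), and the mode. [this work] -/
structure Shape where
  a : ℕ
  h0 : ℕ
  h1 : ℕ
  h2 : ℕ
  mode : Mode

/-- the weights `(p₀, p₁, p₂)` of the sub-law at floor `x` and parameters `t₁, t₂`. [this work] -/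
def Shape.wts {R : Type*} [CommRing R] (sh : Shape) (x t1 t2 : R) : R × R × R :=
  match sh.mode with
  | Mode.zero => (1, 0, 0)
  | Mode.seg => (1 - (x + (1 - x) * t1), x + (1 - x) * t1, 0)
  | Mode.tri => ((1 - (x + (1 - x) * t2)) * (1 - t1), (1 - (x + (1 - x) * t2)) * t1, x + (1 - x) * t2)

/-- **the leaf functional divided by the reach**: `(1−g)·Φ_ν(u) + g·Φ_ν(u+a) − ψ u` with `g = x + (1−x)t_g`; `P` = `ψ` at `u + atoms`, `Q` = `ψ` at
`u + a + atoms`, `Pu = ψ u`. [this work] -/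
def Shape.lhsG {R : Type*} [CommRing R] (sh : Shape) (Pu P0 P1 P2 Q0 Q1 Q2 : R) (x tg t1 t2 : R) : R :=
  let g := x + (1 - x) * tg
  let w := sh.wts x t1 t2
  (1 - g) * (w.1 * P0 + w.2.1 * P1 + w.2.2 * P2) + g * (w.1 * Q0 + w.2.1 * Q1 + w.2.2 * Q2) - Pu

/-- **the mean rate** `A/G = Σ hᵢ pᵢ + a·g`. [this work] -/
def Shape.rate {R : Type*} [CommRing R] (sh : Shape) (x tg t1 t2 : R) : R :=
  let g := x + (1 - x) * tg
  let w := sh.wts x t1 t2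
  (sh.h0 : R) * w.1 + (sh.h1 : R) * w.2.1 + (sh.h2 : R) * w.2.2 + (sh.a : R) * g

/-- coefficients of a degree-≤2 polynomial in `x` from its values at `0, 1/2, 1` (interpolation). [this work] -/
def coef3 {R : Type*} [Field R] (f : R → R) : R × R × R :=
  let c0 := f 0
  let c2 := 2 * (f 1 + f 0 - 2 * f ((1 : R) / 2))
  (c0, f 1 - f 0 - c2, c2)

/-- `lhsG` is the quadratic in `x` with the interpolated coefficients. [this work] -/
theorem Shape.lhsG_eq_poly {R : Type*} [Field R] [CharZero R] (sh : Shape) (Pu P0 P1 P2 Q0 Q1 Q2 tg t1 t2 x : R) :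
    sh.lhsG Pu P0 P1 P2 Q0 Q1 Q2 x tg t1 t2 =
      (coef3 fun z => sh.lhsG Pu P0 P1 P2 Q0 Q1 Q2 z tg t1 t2).1 + (coef3 fun z => sh.lhsG Pu P0 P1 P2 Q0 Q1 Q2 z tg t1 t2).2.1 * x +
        (coef3 fun z => sh.lhsG Pu P0 P1 P2 Q0 Q1 Q2 z tg t1 t2).2.2 * x ^ 2 := by
  unfold coef3 Shape.lhsG Shape.wts
  rcases sh with ⟨a, h0, h1, h2, m⟩
  cases m <;> simp only <;> ring

/-- `rate` is affine in `x`: coefficients from the values at `0` and `1`. [this work] -/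
def coef2 {R : Type*} [CommRing R] (f : R → R) : R × R := (f 0, f 1 - f 0)

/-- `rate` is the affine function with the extracted coefficients. [this work] -/
theorem Shape.rate_eq_poly {R : Type*} [CommRing R] (sh : Shape) (tg t1 t2 x : R) :
    sh.rate x tg t1 t2 = (coef2 fun z => sh.rate z tg t1 t2).1 + (coef2 fun z => sh.rate z tg t1 t2).2 * x := by
  unfold coef2 Shape.rate Shape.wts
  rcases sh with ⟨a, h0, h1, h2, m⟩
  cases m <;> simp only <;> ring

/-- the parameter vertex of a box selected by three bits. [this work] -/
def Box.vert (B : Box) (b0 b1 b2 : Bool) : ℚ × ℚ × ℚ :=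
  (if b0 then B.hi 0 else B.lo 0, if b1 then B.hi 1 else B.lo 1, if b2 then B.hi 2 else B.lo 2)

/-- the list of the eight bit triples. [this work] -/
def bits3 : List (Bool × Bool × Bool) := [(false,false,false),(false,false,true),(false,true,false),(false,true,true),
  (true,false,false),(true,false,true),(true,true,false),(true,true,true)]

/-- the quadratic test of one vertex against one piece `(a,b,c)`: `G·(piece(G, A_v(G)) − LHS_v(G)) = e1 G² + e0 G + e2 ≥ 0` on `[g0,g1]`. [this work] -/
def vertQuadOK (y : ℚ) (cs : ℚ × ℚ × ℚ) (rs : ℚ × ℚ) (p : ℚ × ℚ × ℚ) (g0 g1 : ℚ) : Bool :=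
  quadOK (p.2.1 + p.2.2 * rs.1 - cs.1) (p.1 + p.2.2 * rs.2 * y - cs.2.1 * y) (-(cs.2.2 * y * y)) g0 g1

/-- **the box check** for shape `sh`, `ψ`-values, floor `y`, table `T`, `G`-strip `k`, box `B`: the `A`-range of the box (from the vertices) meets at most two
`A`-cells, and every vertex passes the quadratic test against each of them. [this work] -/
def leafBoxOK (sh : Shape) (Pu P0 P1 P2 Q0 Q1 Q2 : ℚ) (y : ℚ) (T : Tab) (k : ℕ) (B : Box) : Bool :=
  let cs := fun v : ℚ × ℚ × ℚ => coef3 fun z => sh.lhsG Pu P0 P1 P2 Q0 Q1 Q2 z v.1 v.2.1 v.2.2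
  let rs := fun v : ℚ × ℚ × ℚ => coef2 fun z => sh.rate z v.1 v.2.1 v.2.2
  let vs := bits3.map fun b => B.vert b.1 b.2.1 b.2.2
  let As := (vs.map fun v => (rs v).1 * B.g0 + (rs v).2 * y) ++ (vs.map fun v => (rs v).1 * B.g1 + (rs v).2 * y)
  let Alo := As.foldr min (As.headD 0)
  let Ahi := As.foldr max (As.headD 0)
  let llo := idxQ T.ab Alo
  let lhi := idxQ T.ab Ahi
  decide (T.gb.getD k 0 ≤ B.g0) && decide (B.g1 ≤ T.gb.getD (k + 1) 0) && decide (0 ≤ Alo) && decide (lhi ≤ llo + 1) &&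
    vs.all fun v => vertQuadOK y (cs v) (rs v) (T.pc k llo) B.g0 B.g1 && vertQuadOK y (cs v) (rs v) (T.pc k lhi) B.g0 B.g1


/-- `foldr min` is below every element. [folklore] -/
theorem foldr_min_le_of_mem {l : List ℚ} {a z : ℚ} (h : z ∈ l) : l.foldr min a ≤ z := by
  induction l with
  | nil => simp at h
  | cons b l ih =>
    simp only [List.foldr_cons]
    rcases List.mem_cons.1 h with rfl | h'
    · exact min_le_left _ _
    · exact (min_le_right _ _).trans (ih h')

/-- `foldr max` is above every element. [folklore] -/
theorem le_foldr_max_of_mem {l : List ℚ} {a z : ℚ} (h : z ∈ l) : z ≤ l.foldr max a := by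
  induction l with
  | nil => simp at h
  | cons b l ih =>
    simp only [List.foldr_cons]
    rcases List.mem_cons.1 h with rfl | h'
    · exact le_max_left _ _
    · exact (ih h').trans (le_max_right _ _)

/-- lower `G`-cell bound on the index: `gb[k] ≤ t ⟹ k ≤ idx gb t` (increasing breakpoints, `k` a cell index). [this work] -/
theorem le_idx_of_getD_le : ∀ (bs : List ℚ), sortedQ bs = true → ∀ (k : ℕ) (t : ℝ), k + 2 ≤ bs.length → ((bs.getD k 0 : ℚ) : ℝ) ≤ t → k ≤ idx bs t
  | b₀ :: b₁ :: b₂ :: rest, hs, 0, t, _, _ => Nat.zero_le _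
  | b₀ :: b₁ :: b₂ :: rest, hs, k + 1, t, hk, ht => by
    simp only [sortedQ, Bool.and_eq_true, decide_eq_true_eq] at hs
    have hmono : ((b₁ : ℚ) : ℝ) ≤ (((b₁ :: b₂ :: rest).getD k 0 : ℚ) : ℝ) := by
      have := getD_mono (bs := b₁ :: b₂ :: rest) (by simp only [sortedQ, Bool.and_eq_true, decide_eq_true_eq]; exact hs.2) (Nat.zero_le k)
        (by simp only [List.length_cons] at hk ⊢; omega)
      simpa using (show ((b₁ :: b₂ :: rest).getD 0 0 : ℝ) ≤ ((b₁ :: b₂ :: rest).getD k 0 : ℚ) by exact_mod_cast this)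
    have ht' : (((b₁ :: b₂ :: rest).getD k 0 : ℚ) : ℝ) ≤ t := by simpa using ht
    simp only [idx]
    rw [if_neg (not_lt.2 (hmono.trans ht'))]
    exact Nat.succ_le_succ (le_idx_of_getD_le (b₁ :: b₂ :: rest) (by simp only [sortedQ, Bool.and_eq_true, decide_eq_true_eq]; exact hs.2) k t
      (by simp only [List.length_cons] at hk ⊢; omega) ht')
  | [], _, k, _, hk, _ => by simp at hk
  | [_], _, k, _, hk, _ => by simp at hk
  | [_, _], _, k, _, hk, _ => by simp at hk; omega

/-- a coordinate in `[lo, hi]` is `lo + (hi − lo)·s` with `s ∈ [0,1]`. [folklore] -/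
theorem seg_param {lo hi t : ℝ} (h0 : lo ≤ t) (h1 : t ≤ hi) : ∃ s : ℝ, 0 ≤ s ∧ s ≤ 1 ∧ t = lo + (hi - lo) * s := by
  rcases eq_or_lt_of_le (h0.trans h1) with he | hlt
  · exact ⟨0, le_rfl, zero_le_one, by rw [mul_zero, add_zero]; linarith⟩
  · refine ⟨(t - lo) / (hi - lo), div_nonneg (by linarith) (by linarith), ?_, ?_⟩
    · rw [div_le_one (by linarith)]; linarith
    · rw [mul_div_cancel₀ _ (sub_pos.2 hlt).ne']; ring

/-- trilinear interpolation of a function of three variables on the box `[lo, hi]`. [this work] -/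
def interp3 (f : ℝ → ℝ → ℝ → ℝ) (lo hi : Fin 3 → ℝ) (s0 s1 s2 : ℝ) : ℝ :=
  (1 - s0) * ((1 - s1) * ((1 - s2) * f (lo 0) (lo 1) (lo 2) + s2 * f (lo 0) (lo 1) (hi 2)) +
              s1 * ((1 - s2) * f (lo 0) (hi 1) (lo 2) + s2 * f (lo 0) (hi 1) (hi 2))) +
  s0 * ((1 - s1) * ((1 - s2) * f (hi 0) (lo 1) (lo 2) + s2 * f (hi 0) (lo 1) (hi 2)) +
        s1 * ((1 - s2) * f (hi 0) (hi 1) (lo 2) + s2 * f (hi 0) (hi 1) (hi 2)))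

/-- `lhsG` is multilinear in the box parameters. [this work] -/
theorem Shape.lhsG_interp3 (sh : Shape) (Pu P0 P1 P2 Q0 Q1 Q2 x : ℝ) (lo hi : Fin 3 → ℝ) (s0 s1 s2 : ℝ) :
    sh.lhsG Pu P0 P1 P2 Q0 Q1 Q2 x (lo 0 + (hi 0 - lo 0) * s0) (lo 1 + (hi 1 - lo 1) * s1) (lo 2 + (hi 2 - lo 2) * s2)
      = interp3 (fun a b c => sh.lhsG Pu P0 P1 P2 Q0 Q1 Q2 x a b c) lo hi s0 s1 s2 := by
  unfold interp3 Shape.lhsG Shape.wts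
  rcases sh with ⟨a, h0, h1, h2, m⟩
  cases m <;> simp only <;> ring

/-- `rate` is multilinear in the box parameters. [this work] -/
theorem Shape.rate_interp3 (sh : Shape) (x : ℝ) (lo hi : Fin 3 → ℝ) (s0 s1 s2 : ℝ) :
    sh.rate x (lo 0 + (hi 0 - lo 0) * s0) (lo 1 + (hi 1 - lo 1) * s1) (lo 2 + (hi 2 - lo 2) * s2)
      = interp3 (fun a b c => sh.rate x a b c) lo hi s0 s1 s2 := by
  unfold interp3 Shape.rate Shape.wts
  rcases sh with ⟨a, h0, h1, h2, m⟩
  cases m <;> simp only <;> ring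

/-- casting `lhsG` from `ℚ` to `ℝ`. [this work] -/
theorem Shape.lhsG_cast (sh : Shape) (Pu P0 P1 P2 Q0 Q1 Q2 x tg t1 t2 : ℚ) :
    ((sh.lhsG Pu P0 P1 P2 Q0 Q1 Q2 x tg t1 t2 : ℚ) : ℝ) = sh.lhsG (Pu : ℝ) P0 P1 P2 Q0 Q1 Q2 x tg t1 t2 := by
  unfold Shape.lhsG Shape.wts
  rcases sh with ⟨a, h0, h1, h2, m⟩
  cases m <;> simp only <;> push_cast <;> ring

/-- casting `rate` from `ℚ` to `ℝ`. [this work] -/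
theorem Shape.rate_cast (sh : Shape) (x tg t1 t2 : ℚ) : ((sh.rate x tg t1 t2 : ℚ) : ℝ) = sh.rate (x : ℝ) tg t1 t2 := by
  unfold Shape.rate Shape.wts
  rcases sh with ⟨a, h0, h1, h2, m⟩
  cases m <;> simp only <;> push_cast <;> ring


/-- **one vertex**: the quadratic test at a rational parameter vertex gives `G·lhsG ≤ piece(G, G·rate)` there for every `G` in the interval. [this work] -/
theorem vert_sound (sh : Shape) (Pu P0 P1 P2 Q0 Q1 Q2 y : ℚ) (v : ℚ × ℚ × ℚ) (p : ℚ × ℚ × ℚ) (g0 g1 : ℚ)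
    (h : vertQuadOK y (coef3 fun z => sh.lhsG Pu P0 P1 P2 Q0 Q1 Q2 z v.1 v.2.1 v.2.2) (coef2 fun z => sh.rate z v.1 v.2.1 v.2.2) p g0 g1 = true)
    {G : ℝ} (hG : 0 < G) (h0 : (g0 : ℝ) ≤ G) (h1 : G ≤ g1) :
    G * sh.lhsG (Pu : ℝ) P0 P1 P2 Q0 Q1 Q2 ((y : ℝ) / G) v.1 v.2.1 v.2.2
      ≤ ev p G (G * sh.rate ((y : ℝ) / G) (v.1 : ℝ) v.2.1 v.2.2) := by
  unfold vertQuadOK at h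
  have hq := quadOK_sound h h0 h1
  have hG0 : G ≠ 0 := hG.ne'
  set cs := coef3 fun z => sh.lhsG Pu P0 P1 P2 Q0 Q1 Q2 z v.1 v.2.1 v.2.2 with hcs
  set rs := coef2 fun z => sh.rate z v.1 v.2.1 v.2.2 with hrs
  -- the real functional / rate at the vertex are the quadratic / affine functions with the (cast) extracted coefficients
  have eL : ∀ x : ℝ, sh.lhsG (Pu : ℝ) P0 P1 P2 Q0 Q1 Q2 x v.1 v.2.1 v.2.2 = (cs.1 : ℝ) + (cs.2.1 : ℝ) * x + (cs.2.2 : ℝ) * x ^ 2 := by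
    intro x
    rw [hcs]; unfold coef3 Shape.lhsG Shape.wts
    rcases sh with ⟨a, h0', h1', h2', m⟩
    cases m <;> simp only <;> push_cast <;> ring
  have eR : ∀ x : ℝ, sh.rate x (v.1 : ℝ) v.2.1 v.2.2 = (rs.1 : ℝ) + (rs.2 : ℝ) * x := by
    intro x
    rw [hrs]; unfold coef2 Shape.rate Shape.wts
    rcases sh with ⟨a, h0', h1', h2', m⟩
    cases m <;> simp only <;> push_cast <;> ring
  rw [eL, eR]
  unfold ev
  have key : G * (((p.1 : ℝ) + (p.2.1 : ℝ) * G + (p.2.2 : ℝ) * (G * ((rs.1 : ℝ) + (rs.2 : ℝ) * ((y : ℝ) / G))))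
      - G * ((cs.1 : ℝ) + (cs.2.1 : ℝ) * ((y : ℝ) / G) + (cs.2.2 : ℝ) * ((y : ℝ) / G) ^ 2))
      = ((p.2.1 + p.2.2 * rs.1 - cs.1 : ℚ) : ℝ) * G ^ 2 + ((p.1 + p.2.2 * rs.2 * y - cs.2.1 * y : ℚ) : ℝ) * G + ((-(cs.2.2 * y * y) : ℚ) : ℝ) := by
    push_cast
    field_simp
    ring
  have hpos : 0 ≤ G * (((p.1 : ℝ) + (p.2.1 : ℝ) * G + (p.2.2 : ℝ) * (G * ((rs.1 : ℝ) + (rs.2 : ℝ) * ((y : ℝ) / G))))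
      - G * ((cs.1 : ℝ) + (cs.2.1 : ℝ) * ((y : ℝ) / G) + (cs.2.2 : ℝ) * ((y : ℝ) / G) ^ 2)) := by rw [key]; exact hq
  have := (mul_nonneg_iff_of_pos_left hG).1 hpos
  linarith

/-- `interp3` is linear in the function. [this work] -/
theorem interp3_lin (f g : ℝ → ℝ → ℝ → ℝ) (α β γ : ℝ) (lo hi : Fin 3 → ℝ) (s0 s1 s2 : ℝ) :
    interp3 (fun a b c => α + β * f a b c + γ * g a b c) lo hi s0 s1 s2 = α + β * interp3 f lo hi s0 s1 s2 + γ * interp3 g lo hi s0 s1 s2 := by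
  unfold interp3; ring

/-- nonnegative vertex values interpolate to a nonnegative value. [this work] -/
theorem interp3_nonneg {f : ℝ → ℝ → ℝ → ℝ} {lo hi : Fin 3 → ℝ} {s0 s1 s2 : ℝ} (hs0 : 0 ≤ s0) (hs0' : s0 ≤ 1) (hs1 : 0 ≤ s1) (hs1' : s1 ≤ 1)
    (hs2 : 0 ≤ s2) (hs2' : s2 ≤ 1) (hv : ∀ a ∈ ({lo 0, hi 0} : Set ℝ), ∀ b ∈ ({lo 1, hi 1} : Set ℝ), ∀ c ∈ ({lo 2, hi 2} : Set ℝ), 0 ≤ f a b c) :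
    0 ≤ interp3 f lo hi s0 s1 s2 := by
  have m0 : lo 0 ∈ ({lo 0, hi 0} : Set ℝ) := by simp
  have m0' : hi 0 ∈ ({lo 0, hi 0} : Set ℝ) := by simp
  have m1 : lo 1 ∈ ({lo 1, hi 1} : Set ℝ) := by simp
  have m1' : hi 1 ∈ ({lo 1, hi 1} : Set ℝ) := by simp
  have m2 : lo 2 ∈ ({lo 2, hi 2} : Set ℝ) := by simp
  have m2' : hi 2 ∈ ({lo 2, hi 2} : Set ℝ) := by simp
  exact box_nonneg₃ (f := interp3 f lo hi s0 s1 s2) (by unfold interp3; ring) hs0 hs0' hs1 hs1' hs2 hs2'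
    (hv _ m0 _ m1 _ m2) (hv _ m0 _ m1 _ m2') (hv _ m0 _ m1' _ m2) (hv _ m0 _ m1' _ m2')
    (hv _ m0' _ m1 _ m2) (hv _ m0' _ m1 _ m2') (hv _ m0' _ m1' _ m2) (hv _ m0' _ m1' _ m2')

/-- **SOUNDNESS OF THE BOX CHECK**: on the box, `G · lhsG ≤ Z(G, G · rate)`. [this work] -/
theorem leafBox_sound (sh : Shape) (Pu P0 P1 P2 Q0 Q1 Q2 : ℚ) {y : ℚ} {T : Tab} (hw : T.wf = true) {k : ℕ} (hk : k + 2 ≤ T.gb.length)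
    {B : Box} (h : leafBoxOK sh Pu P0 P1 P2 Q0 Q1 Q2 y T k B = true) {G : ℝ} {t : Fin 3 → ℝ} (hm : B.mem G t) (hG : 0 < G)
    (hA1 : G * sh.rate ((y : ℝ) / G) (t 0) (t 1) (t 2) ≤ ((T.ab.getLast?.getD 0 : ℚ) : ℝ)) :
    G * sh.lhsG (Pu : ℝ) P0 P1 P2 Q0 Q1 Q2 ((y : ℝ) / G) (t 0) (t 1) (t 2) ≤ T.Z G (G * sh.rate ((y : ℝ) / G) (t 0) (t 1) (t 2)) := by
  have hw' := hw
  unfold wf at hw; simp only [Bool.and_eq_true, decide_eq_true_eq] at hw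
  obtain ⟨⟨⟨⟨⟨hlen, hsort⟩, halen⟩, hab0⟩, _⟩, hasort⟩ := hw
  unfold leafBoxOK at h
  simp only [Bool.and_eq_true, decide_eq_true_eq, List.all_eq_true] at h
  obtain ⟨⟨⟨⟨hg0k, hg1k⟩, hAlo0⟩, hcells⟩, hall⟩ := h
  obtain ⟨hGlo, hGhi, hti⟩ := hm
  set x : ℝ := (y : ℝ) / G with hx
  -- unit coordinates inside the box
  obtain ⟨s0, hs0, hs0', e0⟩ := seg_param (hti 0).1 (hti 0).2
  obtain ⟨s1, hs1, hs1', e1⟩ := seg_param (hti 1).1 (hti 1).2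
  obtain ⟨s2, hs2, hs2', e2⟩ := seg_param (hti 2).1 (hti 2).2
  set lo : Fin 3 → ℝ := fun i => (B.lo i : ℝ) with hlo
  set hi : Fin 3 → ℝ := fun i => (B.hi i : ℝ) with hhi
  set Lf : ℝ → ℝ → ℝ → ℝ := fun a b c => sh.lhsG (Pu : ℝ) P0 P1 P2 Q0 Q1 Q2 x a b c with hLf
  set Rf : ℝ → ℝ → ℝ → ℝ := fun a b c => sh.rate x a b c with hRf
  have eLf : Lf (t 0) (t 1) (t 2) = interp3 Lf lo hi s0 s1 s2 := by
    rw [e0, e1, e2]; exact sh.lhsG_interp3 (Pu : ℝ) P0 P1 P2 Q0 Q1 Q2 x lo hi s0 s1 s2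
  have eRf : Rf (t 0) (t 1) (t 2) = interp3 Rf lo hi s0 s1 s2 := by
    rw [e0, e1, e2]; exact sh.rate_interp3 x lo hi s0 s1 s2
  -- the absolute mean and its range
  set A : ℝ := G * Rf (t 0) (t 1) (t 2) with hA
  -- names from the checker
  set cs := fun v : ℚ × ℚ × ℚ => coef3 fun z => sh.lhsG Pu P0 P1 P2 Q0 Q1 Q2 z v.1 v.2.1 v.2.2 with hcs
  set rs := fun v : ℚ × ℚ × ℚ => coef2 fun z => sh.rate z v.1 v.2.1 v.2.2 with hrs
  set vs := bits3.map fun b => B.vert b.1 b.2.1 b.2.2 with hvs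
  set As := (vs.map fun v => (rs v).1 * B.g0 + (rs v).2 * y) ++ (vs.map fun v => (rs v).1 * B.g1 + (rs v).2 * y) with hAs
  set Alo := As.foldr min (As.headD 0) with hAlo
  set Ahi := As.foldr max (As.headD 0) with hAhi
  -- every real vertex is a rational vertex of the checker
  have hvert : ∀ a ∈ ({lo 0, hi 0} : Set ℝ), ∀ b ∈ ({lo 1, hi 1} : Set ℝ), ∀ c ∈ ({lo 2, hi 2} : Set ℝ),
      ∃ v ∈ vs, (v.1 : ℝ) = a ∧ (v.2.1 : ℝ) = b ∧ (v.2.2 : ℝ) = c := by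
    intro a ha b hb c hc
    simp only [Set.mem_insert_iff, Set.mem_singleton_iff] at ha hb hc
    rcases ha with rfl | rfl <;> rcases hb with rfl | rfl <;> rcases hc with rfl | rfl
    · exact ⟨B.vert false false false, by simp [hvs, bits3], by simp [Box.vert, hlo]⟩
    · exact ⟨B.vert false false true, by simp [hvs, bits3], by simp [Box.vert, hlo, hhi]⟩
    · exact ⟨B.vert false true false, by simp [hvs, bits3], by simp [Box.vert, hlo, hhi]⟩
    · exact ⟨B.vert false true true, by simp [hvs, bits3], by simp [Box.vert, hlo, hhi]⟩
    · exact ⟨B.vert true false false, by simp [hvs, bits3], by simp [Box.vert, hlo, hhi]⟩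
    · exact ⟨B.vert true false true, by simp [hvs, bits3], by simp [Box.vert, hlo, hhi]⟩
    · exact ⟨B.vert true true false, by simp [hvs, bits3], by simp [Box.vert, hlo, hhi]⟩
    · exact ⟨B.vert true true true, by simp [hvs, bits3], by simp [Box.vert, hhi]⟩
  -- the rate at a rational vertex, as an affine function of G
  have hRv : ∀ v : ℚ × ℚ × ℚ, G * Rf v.1 v.2.1 v.2.2 = ((rs v).1 : ℝ) * G + ((rs v).2 : ℝ) * y := by
    intro v
    have eR : Rf v.1 v.2.1 v.2.2 = ((rs v).1 : ℝ) + ((rs v).2 : ℝ) * x := by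
      rw [hRf, hrs]; simp only
      unfold coef2 Shape.rate Shape.wts
      rcases sh with ⟨a, h0', h1', h2', m⟩
      cases m <;> simp only <;> push_cast <;> ring
    rw [eR, hx]; field_simp
  -- A lies in [Alo, Ahi]
  have hAv_lo : ∀ v ∈ vs, ((Alo : ℚ) : ℝ) ≤ G * Rf v.1 v.2.1 v.2.2 := by
    intro v hv
    rw [hRv v]
    have m0 : (rs v).1 * B.g0 + (rs v).2 * y ∈ As := by
      rw [hAs]; exact List.mem_append_left _ (List.mem_map.2 ⟨v, hv, rfl⟩)
    have m1 : (rs v).1 * B.g1 + (rs v).2 * y ∈ As := by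
      rw [hAs]; exact List.mem_append_right _ (List.mem_map.2 ⟨v, hv, rfl⟩)
    have l0 : ((Alo : ℚ) : ℝ) ≤ (((rs v).1 * B.g0 + (rs v).2 * y : ℚ) : ℝ) := by exact_mod_cast foldr_min_le_of_mem m0
    have l1 : ((Alo : ℚ) : ℝ) ≤ (((rs v).1 * B.g1 + (rs v).2 * y : ℚ) : ℝ) := by exact_mod_cast foldr_min_le_of_mem m1
    push_cast at l0 l1
    exact affine_nonneg_of_ends (α := -((Alo : ℚ) : ℝ) + ((rs v).2 : ℝ) * y) (β := ((rs v).1 : ℝ)) hGlo hGhi (by linarith) (by linarith) |> fun h => by linarith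
  have hAv_hi : ∀ v ∈ vs, G * Rf v.1 v.2.1 v.2.2 ≤ ((Ahi : ℚ) : ℝ) := by
    intro v hv
    rw [hRv v]
    have m0 : (rs v).1 * B.g0 + (rs v).2 * y ∈ As := by
      rw [hAs]; exact List.mem_append_left _ (List.mem_map.2 ⟨v, hv, rfl⟩)
    have m1 : (rs v).1 * B.g1 + (rs v).2 * y ∈ As := by
      rw [hAs]; exact List.mem_append_right _ (List.mem_map.2 ⟨v, hv, rfl⟩)
    have l0 : (((rs v).1 * B.g0 + (rs v).2 * y : ℚ) : ℝ) ≤ ((Ahi : ℚ) : ℝ) := by exact_mod_cast le_foldr_max_of_mem m0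
    have l1 : (((rs v).1 * B.g1 + (rs v).2 * y : ℚ) : ℝ) ≤ ((Ahi : ℚ) : ℝ) := by exact_mod_cast le_foldr_max_of_mem m1
    push_cast at l0 l1
    exact affine_nonneg_of_ends (α := ((Ahi : ℚ) : ℝ) - ((rs v).2 : ℝ) * y) (β := -((rs v).1 : ℝ)) hGlo hGhi (by linarith) (by linarith) |> fun h => by linarith
  have hA_lo : ((Alo : ℚ) : ℝ) ≤ A := by
    have : 0 ≤ interp3 (fun a b c => -((Alo : ℚ) : ℝ) + G * Rf a b c + 0 * Rf a b c) lo hi s0 s1 s2 := by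
      refine interp3_nonneg hs0 hs0' hs1 hs1' hs2 hs2' fun a ha b hb c hc => ?_
      obtain ⟨v, hv, rfl, rfl, rfl⟩ := hvert a ha b hb c hc
      have := hAv_lo v hv; linarith
    rw [interp3_lin] at this
    rw [hA, eRf]; linarith
  have hA_hi : A ≤ ((Ahi : ℚ) : ℝ) := by
    have : 0 ≤ interp3 (fun a b c => ((Ahi : ℚ) : ℝ) + (-G) * Rf a b c + 0 * Rf a b c) lo hi s0 s1 s2 := by
      refine interp3_nonneg hs0 hs0' hs1 hs1' hs2 hs2' fun a ha b hb c hc => ?_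
      obtain ⟨v, hv, rfl, rfl, rfl⟩ := hvert a ha b hb c hc
      have := hAv_hi v hv; linarith
    rw [interp3_lin] at this
    rw [hA, eRf]; linarith
  -- the A-cell of A is one of the two checked cells
  set lA := idx T.ab A with hlA
  have hA0 : ((T.ab.getD 0 0 : ℚ) : ℝ) ≤ A := by
    have e : T.ab.getD 0 0 = 0 := by
      rw [List.getD_eq_getElem _ _ (by omega : 0 < T.ab.length)] 
      have := hab0; rw [List.getD_eq_getElem _ _ (by omega : 0 < T.ab.length)] at this; exact this
    rw [e]; push_cast; exact le_trans (by exact_mod_cast hAlo0) hA_lo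
  have hl_lo : idxQ T.ab Alo ≤ lA := by rw [hlA, ← idx_cast]; exact idx_mono _ hA_lo
  have hl_hi : lA ≤ idxQ T.ab Ahi := by rw [hlA, ← idx_cast]; exact idx_mono _ hA_hi
  have hlA2 : lA + 2 ≤ T.ab.length := idx_lt _ _ halen
  -- Z ≥ own term at cell (k, lA), and that term is the plain piece (G ≤ gb[k+1])
  have hkidx : k ≤ idx T.gb G := le_idx_of_getD_le T.gb hsort k G hk ((by exact_mod_cast hg0k : ((T.gb.getD k 0 : ℚ) : ℝ) ≤ B.g0).trans hGlo)
  have hZ : T.term lA G A k ≤ T.Z G A := by unfold Z; exact term_le_zaux T lA G A hkidx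
  have eqg : T.gb.getD (k + 1) 1 = T.gb.getD (k + 1) 0 := by
    rw [List.getD_eq_getElem _ _ (by omega : k + 1 < T.gb.length), List.getD_eq_getElem _ _ (by omega : k + 1 < T.gb.length)]
  have hmin : min G ((T.gb.getD (k + 1) 1 : ℚ) : ℝ) = G :=
    min_eq_left (by rw [eqg]; exact hGhi.trans (by exact_mod_cast hg1k))
  have hterm : T.term lA G A k = ev (T.pc k lA) G A := by unfold term; rw [hmin]
  -- the piece at (k, lA) dominates G·lhsG on the box, by the vertex principle
  have hpc : T.pc k lA = T.pc k (idxQ T.ab Alo) ∨ T.pc k lA = T.pc k (idxQ T.ab Ahi) := by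
    rcases Nat.eq_or_lt_of_le hl_lo with h1 | h1
    · exact Or.inl (by rw [h1])
    · exact Or.inr (by rw [show lA = idxQ T.ab Ahi by omega])
  have hvq : ∀ v ∈ vs, G * Lf v.1 v.2.1 v.2.2 ≤ ev (T.pc k lA) G (G * Rf v.1 v.2.1 v.2.2) := by
    intro v hv
    obtain ⟨q1, q2⟩ := hall v hv
    rcases hpc with e | e
    · rw [e]; exact vert_sound sh Pu P0 P1 P2 Q0 Q1 Q2 y v _ B.g0 B.g1 q1 hG hGlo hGhi
    · rw [e]; exact vert_sound sh Pu P0 P1 P2 Q0 Q1 Q2 y v _ B.g0 B.g1 q2 hG hGlo hGhi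
  have hD : 0 ≤ interp3 (fun a b c => ev (T.pc k lA) G (G * Rf a b c) - G * Lf a b c) lo hi s0 s1 s2 := by
    refine interp3_nonneg hs0 hs0' hs1 hs1' hs2 hs2' fun a ha b hb c hc => ?_
    obtain ⟨v, hv, rfl, rfl, rfl⟩ := hvert a ha b hb c hc
    have := hvq v hv; linarith
  have hDlin : interp3 (fun a b c => ev (T.pc k lA) G (G * Rf a b c) - G * Lf a b c) lo hi s0 s1 s2
      = ev (T.pc k lA) G (G * interp3 Rf lo hi s0 s1 s2) - G * interp3 Lf lo hi s0 s1 s2 := by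
    unfold ev interp3; ring
  rw [hDlin, ← eRf, ← eLf] at hD
  have : G * Lf (t 0) (t 1) (t 2) ≤ ev (T.pc k lA) G A := by rw [hA]; linarith
  calc G * sh.lhsG (Pu : ℝ) P0 P1 P2 Q0 Q1 Q2 x (t 0) (t 1) (t 2) = G * Lf (t 0) (t 1) (t 2) := by rw [hLf]
    _ ≤ ev (T.pc k lA) G A := this
    _ = T.term lA G A k := hterm.symm
    _ ≤ T.Z G A := hZ

end Tab
end LawDec
end Quant
end Summit.CriticalPhenomena.PercolationContinuityZ3.Theorems
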